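import Literature.AnabelianGeometry.AbsoluteAnabelian.AbsAnabProp121viiSub
import Literature.AnabelianGeometry.AbsoluteAnabelian.MLFGaloisGroupsHolds
import Literature.AnabelianGeometry.AbsoluteAnabelian.MLFUnitImageReductionProofs
import HarnessLib

/-!
# [AbsAnab] Prop 1.2.1 (vii), sub-DAG row L07 `UnrCharTransport` — PROVED
# ("group-theoretic, by (ii), (iv)": the normalised unramified character is preserved by `α`)

S. Mochizuki, *The Absolute Anabelian Geometry of Hyperbolic Curves* (2004) [AbsAnab], §1.2,
Prop 1.2.1 (vii), printed proof p. 11 – p. 12 l. 1 (lit key paper:url-e8f118cc205e): the last arrow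
`H²(Gal(K^unr/K), (K^unr)^×) ⥲ H²(Ẑ, ℤ) = ℚ/ℤ` "is group-theoretic, by (ii), (iii), (iv)" — i.e.
`α : G_{K₁} ≅ G_{K₂}` carries the inertia group `I_{K₁}` onto `I_{K₂}` (Prop 1.2.1 (ii)) and
Frobenius lifts to Frobenius lifts (Prop 1.2.1 (iv)), so the character of `Gal(K^unr/K) ≅ Ẑ`
normalised by `Frob ↦ 1` is preserved.  Row L07 of `plan/L4/SUBDAG-AbsAnab-Prop121vii.md`
(`Prop121vii.UnrCharTransport` of `AbsAnabProp121viiSub.lean`), PROVED for `K₁, K₂ : Type` from the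
tree's unconditional theorems `galoisMLF_iso_inertia_holds`, `galoisMLF_iso_frobenius_holds`
(`MLFGaloisGroupsHolds.lean`, abc-iut-L4-t11/L4-t4, `ℚ_p`-binder model) through the bridges of
`MLFUnitImageReductionProofs.lean` / `MLFInertiaBridgeProofs.lean`
(`inertiaSubgroupMLF_eq_absInertia`, `isFrobeniusLiftMLF_iff_isFrobPow_one`, the `ℚ_p`-algebra
structure `LocalField.padicAlgebra`).  Universe `0` only (the input facts bind `K : Type`).
Proof-only (abc-iut seat w5-d198); nothing here bears on [IUTchIII] Cor. 3.12.
-/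

noncomputable section

namespace Literature.AnabelianGeometry.AbsoluteAnabelian

namespace Prop121vii

open Field ValuativeRel
open Literature.NumberTheory.GaloisRepresentations
open Literature.NumberTheory.GaloisRepresentations.IsNonarchimedeanLocalField

/-- **`α(I_{K₁}) = I_{K₂}`** in the valued vocabulary (`absInertia`), from Prop 1.2.1 (ii)
(`galoisMLF_iso_inertia_holds`) through `inertiaSubgroupMLF_eq_absInertia`.
[cite: MochizukiAbsAnab2004, Prop 1.2.1 (ii) p.10] -/
theorem map_absInertia_eq {K₁ K₂ : Type} [Field K₁] [ValuativeRel K₁] [TopologicalSpace K₁]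
    [IsNonarchimedeanLocalField K₁] [CharZero K₁] [Field K₂] [ValuativeRel K₂] [TopologicalSpace K₂]
    [IsNonarchimedeanLocalField K₂] [CharZero K₂]
    (α : absoluteGaloisGroup K₁ ≃ₜ* absoluteGaloisGroup K₂) :
    (absInertia K₁).map α.toMulEquiv.toMonoidHom = absInertia K₂ := by
  obtain ⟨hp₁, hv₁⟩ := prime_ringChar_residueField_and_valuation_lt_one (K := K₁)
  obtain ⟨hp₂, hv₂⟩ := prime_ringChar_residueField_and_valuation_lt_one (K := K₂)
  haveI : Fact (ringChar 𝓀[K₁]).Prime := ⟨hp₁⟩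
  haveI : Fact (ringChar 𝓀[K₂]).Prime := ⟨hp₂⟩
  letI := LocalField.padicAlgebra K₁ (ringChar 𝓀[K₁]) hv₁
  letI := LocalField.padicAlgebra K₂ (ringChar 𝓀[K₂]) hv₂
  haveI : FiniteDimensional ℚ_[ringChar 𝓀[K₁]] K₁ :=
    Literature.NumberTheory.PAdicHodge.PadicBase.instFiniteDimensional (F := K₁) hv₁
  haveI : FiniteDimensional ℚ_[ringChar 𝓀[K₂]] K₂ :=
    Literature.NumberTheory.PAdicHodge.PadicBase.instFiniteDimensional (F := K₂) hv₂
  have := galoisMLF_iso_inertia_holds (ringChar 𝓀[K₁]) (ringChar 𝓀[K₂]) K₁ K₂ α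
  rwa [inertiaSubgroupMLF_eq_absInertia rfl, inertiaSubgroupMLF_eq_absInertia rfl] at this

/-- **`α` maps arithmetic-Frobenius lifts to arithmetic-Frobenius lifts** in the valued vocabulary
(`IsFrobPow σ 1`), from Prop 1.2.1 (iv) (`galoisMLF_iso_frobenius_holds`) through
`isFrobeniusLiftMLF_iff_isFrobPow_one`. [cite: MochizukiAbsAnab2004, Prop 1.2.1 (iv) p.10] -/
theorem isFrobPow_one_map {K₁ K₂ : Type} [Field K₁] [ValuativeRel K₁] [TopologicalSpace K₁]
    [IsNonarchimedeanLocalField K₁] [CharZero K₁] [Field K₂] [ValuativeRel K₂] [TopologicalSpace K₂]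
    [IsNonarchimedeanLocalField K₂] [CharZero K₂]
    (α : absoluteGaloisGroup K₁ ≃ₜ* absoluteGaloisGroup K₂) {σ : absoluteGaloisGroup K₁}
    (hσ : IsFrobPow σ 1) : IsFrobPow (α σ) 1 := by
  obtain ⟨hp₁, hv₁⟩ := prime_ringChar_residueField_and_valuation_lt_one (K := K₁)
  obtain ⟨hp₂, hv₂⟩ := prime_ringChar_residueField_and_valuation_lt_one (K := K₂)
  haveI : Fact (ringChar 𝓀[K₁]).Prime := ⟨hp₁⟩
  haveI : Fact (ringChar 𝓀[K₂]).Prime := ⟨hp₂⟩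
  letI := LocalField.padicAlgebra K₁ (ringChar 𝓀[K₁]) hv₁
  letI := LocalField.padicAlgebra K₂ (ringChar 𝓀[K₂]) hv₂
  haveI : FiniteDimensional ℚ_[ringChar 𝓀[K₁]] K₁ :=
    Literature.NumberTheory.PAdicHodge.PadicBase.instFiniteDimensional (F := K₁) hv₁
  haveI : FiniteDimensional ℚ_[ringChar 𝓀[K₂]] K₂ :=
    Literature.NumberTheory.PAdicHodge.PadicBase.instFiniteDimensional (F := K₂) hv₂
  rw [← isFrobeniusLiftMLF_iff_isFrobPow_one (K := K₂) rfl]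
  exact galoisMLF_iso_frobenius_holds (ringChar 𝓀[K₁]) (ringChar 𝓀[K₂]) K₁ K₂ α σ
    ((isFrobeniusLiftMLF_iff_isFrobPow_one (K := K₁) rfl σ).mpr hσ)

/-- **Row L07 `UnrCharTransport` — PROVED** (`K₁, K₂ : Type`): for `α : G_{K₁} ≅ G_{K₂}` and a
character `χ₂ : G_{K₂} → ℤ/n` killing `I_{K₂}` with value `1` on Frobenius lifts, `χ₂ ∘ α` kills
`I_{K₁}` and has value `1` on the Frobenius lifts of `K₁` ("group-theoretic, by (ii), (iv)", p. 12
l. 1). [cite: MochizukiAbsAnab2004, Prop 1.2.1 (vii) p.11] -/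
theorem unrCharTransport_holds {K₁ K₂ : Type} [Field K₁] [ValuativeRel K₁] [TopologicalSpace K₁]
    [IsNonarchimedeanLocalField K₁] [CharZero K₁] [Field K₂] [ValuativeRel K₂] [TopologicalSpace K₂]
    [IsNonarchimedeanLocalField K₂] [CharZero K₂]
    (α : absoluteGaloisGroup K₁ ≃ₜ* absoluteGaloisGroup K₂) (n : ℕ) : UnrCharTransport α n := by
  intro χ₂ _ hI hF
  refine ⟨fun σ hσ => hI _ ?_, fun σ hσ => hF _ (isFrobPow_one_map α hσ)⟩
  rw [← map_absInertia_eq α]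
  exact Subgroup.mem_map_of_mem _ hσ

end Prop121vii

end Literature.AnabelianGeometry.AbsoluteAnabelian
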